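import Mathlib
import Literature.MathematicalPhysics.QuantumFieldTheory.Balaban1983to89.B5Prop11Inverse
import Literature.MathematicalPhysics.QuantumFieldTheory.Balaban1983to89.B5Adjoint176

/-!
# B5 (1.69)/(1.83): the term `Q*Q` — position space `(Q_k)ᴴQ_k` IS, fiberwise in momentum space,
# the matrix `Q*Q` of the fiber algebra of `B5Prop11Inverse` (pass 5) at B5's data `u, v_μ`

Source: T. Bałaban, *Propagators and renormalization transformations for lattice gauge
theories. I*, Commun. Math. Phys. 95 (1984) 17–40 (`Balaban1984PropagatorsI`, "B5"), renders
`b2b-balaban-ref1/pages/1984-cmp95-propagators-rt-I/…-pNNN-x2.png` (PDF page = journal page − 16),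
read as images.

## What the paper prints (verbatim)

* p. 29 [PDF 13], (1.69): «⟨A, Δ_a A⟩ = ⟨A, ∂*∂A⟩ + ⟨A, ∂R∂*A⟩ + a⟨A, Q*QA⟩ = ⟨A, ΔA⟩ − ⟨A, ∂P∂*A⟩
  + a⟨A, Q*QA⟩, Δ = ∂*∂ + ∂∂*, R = I − P,»; p. 30 [PDF 14], (1.73): «ΔA − ∂Δ⁻¹Q′*(Q′Δ⁻²Q′*)⁻¹Q′Δ⁻¹∂*A
  + aQ*QA = J has a unique solution for the arbitrary vector function J.»; (1.76): «φ = I + aQΔ⁻¹Q*».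
* p. 28 [PDF 12], (1.61): «(Q̃A)_μ(p′) = Σ_l u(p′+l) v_μ(p′+l) Ã_μ(p′+l)»; p. 31 [PDF 15], (1.84):
  «φ_μ(p′) = 1 + aΣ_{l″}|u(p′+l″)|²|v_μ(p′+l″)|²/Δ(p′+l″) for p′ ≠ 0».

## What is typed and certified here (kernel-checked, zero sorry)

`B5Prop11Inverse` (pass 5) certified the algebra (1.73) ⟹ (1.83) for an ABSTRACT fiber
`F : Fiber Λ d`, with `Q` the fiber matrix `Qv F` (`(Qv F)_{μ,(l,κ)} = [κ = μ] u(l) v_μ(l)`) and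
`Q*Q = (Qv F)ᴴ(Qv F)`; `B5Prop11Fiber.balabanFiber` (pass 3) is B5's data `u = uSym`, `v = vSym`,
`Δ` at `p′ ↔ s = sOf M q`, `q ≠ 0`.  Here the position-space operator `(Q_k)ᴴ Q_k` of
`B5Block118`/`B5Adjoint176` is identified with that fiber matrix:
* `dft_QvOp_adjoint_QvOp` — for every `q` (also `p′ = 0`):
  `((Q_k)ᴴQ_kA)^_κ(p′+l) = c² · \overline{u v_κ(p′+l)} · Σ_{l′} u v_κ(p′+l′) Â_κ(p′+l′)`;
* `fiberAt`, `fiberAt_u`, `fiberAt_v` — pass 3's fiber at `s = sOf M q`, `q ≠ 0`;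
* `QvH_mul_Qv_apply` — the entries of pass 5's `Q*Q = (Qv F)ᴴ(Qv F)` at that fiber;
* `fiber_QstarQ` — THE IDENTIFICATION: for `q ≠ 0`,
  `((Q_k)ᴴQ_kA)^_κ(p′+l) = c² Σ_{(l′,κ′)} (Q*Q)_{(l,κ),(l′,κ′)} Â_{κ′}(p′+l′)` with `Q*Q` the pass-5
  matrix at `fiberAt q` and `c = cQ = (√(n^d))⁻¹` (`= 1` in B5's normalisation).
So the `aQ*Q` of (1.69)/(1.73), typed abstractly in pass 5, is the conjugated position-space
`a(Q_k)ᴴQ_k` up to the normalisation constant `c²` and the pairing weight (D-pv15g2.12/13).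

## What is NOT certified here

The same identification for the `Δ` and `∂P∂*` terms of `Δ_a` (so `calDa` of pass 5 as a whole);
the zero fiber `q = 0` against pass 5's `Qv₀`; fields complex.
-/

open scoped BigOperators Matrix ComplexConjugate
open Finset Complex

namespace Literature.MathematicalPhysics.QuantumFieldTheory.Balaban1983to89.B5FiberQQ

open Literature.MathematicalPhysics.QuantumFieldTheory.Balaban1983to89.B5Prop11Fiber
open Literature.MathematicalPhysics.QuantumFieldTheory.Balaban1983to89.B5Prop11Plancherel
open Literature.MathematicalPhysics.QuantumFieldTheory.Balaban1983to89.B5Action121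
open Literature.MathematicalPhysics.QuantumFieldTheory.Balaban1983to89.B5Block118
open Literature.MathematicalPhysics.QuantumFieldTheory.Balaban1983to89.B5Adjoint176

noncomputable section

variable {d : ℕ} (n : ℕ) [NeZero n] (M : Fin d → ℕ) [hM : ∀ μ, NeZero (M μ)]

/-- `((Q_k)ᴴQ_kA)^_κ(p′+l) = c²·\overline{u v_κ(p′+l)}·Σ_{l′} u v_κ(p′+l′) Â_κ(p′+l′)` — the term
`Q*Q` of (1.69)/(1.73) in momentum space, every `p′` ((1.61) with `B5Adjoint176.dft_QvOp_adjoint`).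
[cite: Balaban1984PropagatorsI, (1.69) p.29, (1.61) p.28] -/
theorem dft_QvOp_adjoint_QvOp (A : Tor (fine n M) × Fin d → ℂ) (k : Fin d → Fin n) (q : Tor M)
    (κ : Fin d) :
    (dft (fine n M) *ᵥ comp (fine n M) ((QvOp n M)ᴴ *ᵥ (QvOp n M *ᵥ A)) κ) (pOf n M (k, q))
      = (cQ n M : ℂ) ^ 2 * (conj (uSym n k (sOf M q) * vSym n k (sOf M q) κ)
          * ∑ k' : Fin d → Fin n, uSym n k' (sOf M q) * vSym n k' (sOf M q) κ
              * (dft (fine n M) *ᵥ comp (fine n M) A κ) (pOf n M (k', q))) := by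
  rw [dft_QvOp_adjoint, dft_QvOp]
  ring

/-- B5's fiber data at `p′ ↔ q ≠ 0`: pass 3's `balabanFiber` at `s = sOf M q` (`|s_μ| ≤ π`, `s ≠ 0`).
[cite: Balaban1984PropagatorsI, (1.83) p.31] -/
def fiberAt (hn : 1 ≤ n) (a : ℝ) (ha : 0 < a) (q : Tor M) (hq : q ≠ 0) :
    B5Prop11Bound.Fiber (Fin d → Fin n) d :=
  balabanFiber n hn a ha (sOf M q) (abs_sOf_le M q) (sOf_ne_zero M hq)

/-- `u` of the fiber at `q` is `uSym(·, sOf q)`. [folklore] -/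
theorem fiberAt_u (hn : 1 ≤ n) (a : ℝ) (ha : 0 < a) (q : Tor M) (hq : q ≠ 0) (k : Fin d → Fin n) :
    (fiberAt n M hn a ha q hq).u k = uSym n k (sOf M q) := rfl

/-- `v_μ` of the fiber at `q` is `vSym(·, sOf q) μ`. [folklore] -/
theorem fiberAt_v (hn : 1 ≤ n) (a : ℝ) (ha : 0 < a) (q : Tor M) (hq : q ≠ 0) (μ : Fin d)
    (k : Fin d → Fin n) :
    (fiberAt n M hn a ha q hq).v μ k = vSym n k (sOf M q) μ := rfl

/-- the entries of pass 5's `Q*Q = (Qv F)ᴴ(Qv F)` at the fiber: `(Q*Q)_{(l,κ),(l′,κ′)} =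
[κ′ = κ] \overline{u v_κ(l)} u v_κ(l′)`. [folklore] -/
theorem QvH_mul_Qv_apply (hn : 1 ≤ n) (a : ℝ) (ha : 0 < a) (q : Tor M) (hq : q ≠ 0)
    (k : Fin d → Fin n) (κ : Fin d) (i : (Fin d → Fin n) × Fin d) :
    ((B5Prop11Inverse.Qv (fiberAt n M hn a ha q hq))ᴴ * B5Prop11Inverse.Qv (fiberAt n M hn a ha q hq))
        (k, κ) i
      = if i.2 = κ then
          conj (uSym n k (sOf M q) * vSym n k (sOf M q) κ)
            * (uSym n i.1 (sOf M q) * vSym n i.1 (sOf M q) κ)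
        else 0 := by
  rw [Matrix.mul_apply, Finset.sum_eq_single κ]
  · by_cases h : i.2 = κ
    · rw [if_pos h]
      simp only [Matrix.conjTranspose_apply, B5Prop11Inverse.Qv, h, if_true]
      rfl
    · rw [if_neg h]
      simp only [Matrix.conjTranspose_apply, B5Prop11Inverse.Qv, h, if_false, mul_zero]
  · intro μ _ hμ
    simp only [Matrix.conjTranspose_apply, B5Prop11Inverse.Qv, if_neg (Ne.symm hμ), star_zero,
      zero_mul]
  · intro h
    exact absurd (Finset.mem_univ κ) h

/-- THE IDENTIFICATION (q ≠ 0): `((Q_k)ᴴQ_kA)^_κ(p′+l) = c² Σ_{(l′,κ′)} (Q*Q)_{(l,κ),(l′,κ′)} Â_{κ′}(p′+l′)`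
with `Q*Q = (Qv F)ᴴ(Qv F)` the pass-5 fiber matrix at `F = fiberAt q` — the `aQ*Q` of (1.69)/(1.73)
is the conjugated position-space `a(Q_k)ᴴQ_k` (up to `c² = n^{-d}`, `= 1` in B5's normalisation).
[cite: Balaban1984PropagatorsI, (1.69) p.29, (1.73) p.30] -/
theorem fiber_QstarQ (hn : 1 ≤ n) (a : ℝ) (ha : 0 < a) (A : Tor (fine n M) × Fin d → ℂ)
    (k : Fin d → Fin n) {q : Tor M} (hq : q ≠ 0) (κ : Fin d) :
    (dft (fine n M) *ᵥ comp (fine n M) ((QvOp n M)ᴴ *ᵥ (QvOp n M *ᵥ A)) κ) (pOf n M (k, q))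
      = (cQ n M : ℂ) ^ 2 * ∑ i : (Fin d → Fin n) × Fin d,
          ((B5Prop11Inverse.Qv (fiberAt n M hn a ha q hq))ᴴ
              * B5Prop11Inverse.Qv (fiberAt n M hn a ha q hq)) (k, κ) i
            * (dft (fine n M) *ᵥ comp (fine n M) A i.2) (pOf n M (i.1, q)) := by
  rw [dft_QvOp_adjoint_QvOp]
  congr 1
  simp_rw [QvH_mul_Qv_apply]
  rw [Fintype.sum_prod_type]
  simp only [ite_mul, zero_mul, Finset.sum_ite_eq', Finset.mem_univ, if_true]
  rw [Finset.mul_sum]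
  exact Finset.sum_congr rfl fun k' _ => by ring

end

end Literature.MathematicalPhysics.QuantumFieldTheory.Balaban1983to89.B5FiberQQ
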